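import Summits.RiemannHypothesis.RiemannHypothesis.Theorems.Splittings.ZdTruncationTails
import Literature.Barriers.RiemannHypothesis.TuranPartialSumsHolds
import HarnessLib

/-!
# Truncation tails — the certified twins (zd-neg g10 §3, computational closure)

Cell rh-split, seat rh-split-zd-neg g10 (brief sha16 f79c5f09d8bcb036), card `run/shared/lean/pub/rh-split/cards/SPLIT-zd-neg.md` GEN-10
(N65–N68, R57–R61, B11–B12 + SUPPLEMENT); source `HOME/rh-split-zd-neg/SketchG10.lean` v2 sha16 29368ce59f30369a (namespace `RhSplitZdNegG10`),
referee rh-split-ref-2 g0: GEN-10 REPLAY PASS on kernel v2 + CONTENT read-backs R1–R10 + LABELS N65–N68 UPHELD (2026-08-27T09:34:25Z, `INBOX.md`);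
lead rh-split-lead g3; CARVE MAP + CUT.md in `HOME/rh-split-zd-neg/carve-g10/`.  Deltas vs the source (CUT.md): namespace ↦ `…Splittings.<lane>`, the scratch
abbreviations `FIN` / `H₀` SPELLED OUT (`riemannHypothesisUpTo_platt_trudgian` / `3000175332800`), the §0/§1 frame decls CITED from the tree
(`Splittings.ZdReferencePinsFrame`: `RHAbove`, `rh_of_fin_of_rhAbove`, `rhAbove_of_rh`, `two_le_count_jump`, `zetaArgS_sub`) instead of restated,
`primesLE_mono` ↦ Mathlib `Nat.primesLE_mono`, `abs_sin_sub_sin_le` privatised, docstrings added to helper decls; decl text otherwise byte-verbatim.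

This file: `not_sectionTailAbove'` and `not_sectionZeroFreeAbove (29 ≤ N)` through the tree's certified assembly `TuranPartialSums_holds`; by closure they carry exactly
the `Literature.Barriers.RiemannHypothesis.TuranShift.Cert.cover{1,2,3}_ok` / `…LowCert.blocks{1,2,3}_ok` `native_decide` axioms (declared COMPUTATIONAL;
file `--computational`). The standard-axiom refutation `not_sectionTailAbove` is in `ZdTruncationTails.lean`.

HONEST LABEL: «SPLITTING SEARCH over kernel-typed RH-EQUIVALENCES; a splitting A ∧ B ⟹ RH is CONDITIONAL bookkeeping unless A and B are
both proved; nothing here bears on the truth of RH.»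
-/

set_option linter.dupNamespace false

noncomputable section

open Filter Complex Metric Set
open scoped Real Topology

namespace Summit.RiemannHypothesis.RiemannHypothesis.Theorems.Splittings.ZdTruncationTails

open Literature.NumberTheory.DiophantineGeometry Literature.NumberTheory.LFunctions
  Literature.Barriers.RiemannHypothesis MeasureTheory

/-- REFUTED again through the certified Platt–Trudgian / Monach assembly `TuranPartialSums_holds`
(every `ζ_N`, `N ≥ 29`, vanishes somewhere in `σ > 1`; computational axioms). -/
theorem not_sectionTailAbove' (H : ℝ) : ¬ SectionTailAbove H := fun h ↦
  TuranPartialSums_holds.not_hypothesis ((sectionTailAbove_iff H).1 h)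

/-- Per-`N` form used by the card: for EACH fixed `N ≥ 29` the tail "`ζ_N ≠ 0` in `σ > 1`, `t > H`"
is false for every `H`. -/
theorem not_sectionZeroFreeAbove {N : ℕ} (hN : 29 ≤ N) (H : ℝ) :
    ¬ ∀ s : ℂ, 1 < s.re → H < s.im → zetaPartialSum N s ≠ 0 := by
  intro h
  obtain ⟨s, hs1, hs0⟩ := TuranPartialSums_holds N hN
  exact (sectionZeroFreeAbove_iff N H).1 h s hs1 hs0

end Summit.RiemannHypothesis.RiemannHypothesis.Theorems.Splittings.ZdTruncationTails

end
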